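import Mathlib
import HarnessLib
import Summits.Ventures.LatticeQCDFlow.Exactness.IMHColdStartExitTime
import Summits.Ventures.LatticeQCDFlow.Scaling.AutoregressiveGaugeAllClosingColdExact

/-!
# LatticeQCDFlow / Scaling — the cold-started exact all-closing conditioner for EVERY compact gauge group, finite groups included: the exact law of the EXIT time from the cold configuration and of the run after it, `A = Z/∏_ℓ c_{#C_ℓ}`

HONEST FRAMING: exact (Metropolis-corrected) sampling algorithms for lattice gauge theory;
figures of merit are autocorrelation/cost numbers at stated couplings and volumes; no
continuum-physics claim.

Venture `LatticeQCDFlow` (cell pub-lqcd), topic `Scaling`, FANOUT row 30 (lean-1, GEN-34) — OUR WORK, the gauge instance of this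
generation's abstract `Exactness/IMHColdStartExitTime`.  Setting as in GEN-28's `allClosing_cold_acceptMass_eq` (`L ≥ 2`, `w` continuous,
`0 < m ≤ w ≤ M`, `w(g⁻¹) = w(g)`, a closing assignment `(T, C)` partitioning the plaquettes; exact sampler `K = indepMH q w`, cold configuration
`U ≡ 1` = the mode of the importance weight, `A = Z/∏_ℓ c_{#C_ℓ}`); NO atom-freeness of the Haar measure is assumed, so the compact
group `G` may be FINITE (`ℤ_N`, …): then the Haar proposal has an atom at the cold configuration, `π₀ = π{cold} > 0`, an accepted
proposal may BE the cold configuration, and GEN-33's thaw-time files (`…ThawTime`, atom-free) do not apply.  With `ρ = 1 − A(1 − π₀)`: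

* **`allClosing_coldStart_exitAt_inter_shift`** — `P_cold(U_0 = … = U_t = cold, U_{t+1} ≠ cold, U_{t+1+·} ∈ E) = A·ρ^t·P_π(E ∩ {U_0 ≠ cold})`;
* **`allClosing_coldStart_exitAt`** — THE EXIT TIME IS GEOMETRIC with success probability `A(1 − π₀)` (mean `1/(A(1 − π₀))`);
* **`allClosing_coldStart_firstExit`** — the first configuration off the cold one: `P(T = t+1, U_T ∈ B) = A·ρ^t·π(B ∖ {cold})`;
* **`allClosing_coldStart_exitedRun`** — summed over the exit time (`π₀ < 1`): the run recorded from the first exit is, in law, THE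
  EQUILIBRIUM RUN CONDITIONED TO START OFF THE COLD CONFIGURATION; **`allClosing_coldStart_exits`** — the chain leaves a.s.

For `U(1)`, `SU(N)` (`π₀ = 0`, `ρ = 1 − A`) these are GEN-33's thaw-time statements.  NOT CLAIMED: any value of `A` or `π₀`; the
accept-bit (augmented) chain, for which «discard until the first acceptance» gives the equilibrium run exactly.

The `Fact` instance is the measurability of the kernel weight (discharged by the measurability clause of GEN-28's
acceptance-mass theorem).  No `def`, no `sorry`, nothing cited as a fact beyond the tree.
-/

noncomputable section

namespace Summit.Ventures.LatticeQCDFlow.Theory2.Autoregressive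

open MeasureTheory ProbabilityTheory Function Finset
open scoped ENNReal
open Literature.MathematicalPhysics.QuantumFieldTheory Literature.MathematicalPhysics.QuantumLattice
open Summit.Ventures.LatticeQCDFlow.Exactness Summit.Ventures.LatticeQCDFlow.Scoring

variable {d L : ℕ} [NeZero L] {G : Type*} [Group G] [TopologicalSpace G] [IsTopologicalGroup G]
  [CompactSpace G] [SecondCountableTopology G] [MeasurableSpace G] [BorelSpace G]
/-- **THE JOINT LAW OF THE EXIT TIME AND THE RUN AFTER IT — every compact group, finite groups included** (exact all-closing conditioner, `A = Z/∏_ℓ c_{#C_ℓ}`, `π₀ = π{cold}`, `ρ = 1 − A(1 − π₀)`): for every `t` and every measurable set of runs `E`, `P_cold(U_0 = … = U_t = cold, U_{t+1} ≠ cold, U_{t+1+·} ∈ E) = A·ρ^t·P_π(E ∩ {U_0 ≠ cold})` EXACTLY. [ours] -/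
theorem allClosing_coldStart_exitAt_inter_shift [MeasurableSingletonClass G] (hL : 2 ≤ L) {w : G → ℝ} (hw : Continuous w) {m M : ℝ} (hm0 : 0 < m)
    (hm : ∀ g, m ≤ w g) (hM : ∀ g, w g ≤ M) (hwinv : ∀ g, w g⁻¹ = w g)
    (T : Finset (Edge d L)) (C : Edge d L → Finset (Plaquette d L))
    (hCne : ∀ ℓ ∈ T, (C ℓ).Nonempty)
    (hCe : ∀ ℓ ∈ T, ∀ p ∈ C ℓ, ℓ ∈ ({(p.1, p.2.1.1), (p.1.shift p.2.1.1, p.2.1.2),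
        (p.1.shift p.2.1.2, p.2.1.1), (p.1, p.2.1.2)} : Finset (Edge d L)))
    (hdisj : ∀ ℓ ∈ T, ∀ ℓ' ∈ T, ℓ ≠ ℓ' → Disjoint (C ℓ) (C ℓ'))
    (hcover : ∀ p : Plaquette d L, ∃ ℓ ∈ T, p ∈ C ℓ)
    (π q : Measure (GaugeConfig d L G)) [IsProbabilityMeasure π] [IsProbabilityMeasure q]
    (hπ : π = (Measure.pi fun _ : Edge d L => haarProbability G).withDensity fun U =>
      ENNReal.ofReal ((∏ p : Plaquette d L, w (plaquetteHolonomy U p.1 p.2.1.1 p.2.1.2)) /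
        ∫ V, ∏ p : Plaquette d L, w (plaquetteHolonomy V p.1 p.2.1.1 p.2.1.2) ∂(Measure.pi fun _ : Edge d L => haarProbability G)))
    (hq : q = (Measure.pi fun _ : Edge d L => haarProbability G).withDensity fun U =>
      ENNReal.ofReal (∏ ℓ ∈ T, (∏ p ∈ C ℓ, w (plaquetteHolonomy U p.1 p.2.1.1 p.2.1.2)) /
          (∫ v, ∏ p ∈ C ℓ, w (plaquetteHolonomy (update U ℓ v) p.1 p.2.1.1 p.2.1.2) ∂(haarProbability G))))
    [Fact (Measurable (fun U =>
        (((∫ V, ∏ p : Plaquette d L, w (plaquetteHolonomy V p.1 p.2.1.1 p.2.1.2) ∂(Measure.pi fun _ : Edge d L => haarProbability G)) /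
          ∏ ℓ ∈ T, (∫ v, ∏ p ∈ C ℓ, w (plaquetteHolonomy (update U ℓ v) p.1 p.2.1.1 p.2.1.2) ∂(haarProbability G))))⁻¹))]
    (s : ℕ) {E : Set (ℕ → GaugeConfig d L G)} (hE : MeasurableSet E) :
    (Kernel.trajMeasure (X := fun _ : ℕ => GaugeConfig d L G) (Measure.dirac (fun _ : Edge d L => (1 : G)))
        (fun n : ℕ => (indepMH q (fun U =>
        (((∫ V, ∏ p : Plaquette d L, w (plaquetteHolonomy V p.1 p.2.1.1 p.2.1.2) ∂(Measure.pi fun _ : Edge d L => haarProbability G)) /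
          ∏ ℓ ∈ T, (∫ v, ∏ p ∈ C ℓ, w (plaquetteHolonomy (update U ℓ v) p.1 p.2.1.1 p.2.1.2) ∂(haarProbability G))))⁻¹)).comap
          (fun h : (i : ↥(Finset.Iic n)) → GaugeConfig d L G => h ⟨n, Finset.mem_Iic.2 le_rfl⟩)
          (measurable_pi_apply _))) {x : ℕ → GaugeConfig d L G | (∀ i, i ≤ s → x i = (fun _ : Edge d L => (1 : G))) ∧ x (s + 1) ≠ (fun _ : Edge d L => (1 : G)) ∧ (fun n => x (s + 1 + n)) ∈ E} =
      ENNReal.ofReal (((∫ V, ∏ p : Plaquette d L, w (plaquetteHolonomy V p.1 p.2.1.1 p.2.1.2) ∂(Measure.pi fun _ : Edge d L => haarProbability G)) /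
        ∏ ℓ ∈ T, ∫ h, w h ^ (C ℓ).card ∂(haarProbability G)) * (1 - ((∫ V, ∏ p : Plaquette d L, w (plaquetteHolonomy V p.1 p.2.1.1 p.2.1.2) ∂(Measure.pi fun _ : Edge d L => haarProbability G)) /
        ∏ ℓ ∈ T, ∫ h, w h ^ (C ℓ).card ∂(haarProbability G)) * (1 - π.real ({(fun _ : Edge d L => (1 : G))} : Set (GaugeConfig d L G)))) ^ s) *
        (Kernel.trajMeasure (X := fun _ : ℕ => GaugeConfig d L G) π
        (fun n : ℕ => (indepMH q (fun U =>
        (((∫ V, ∏ p : Plaquette d L, w (plaquetteHolonomy V p.1 p.2.1.1 p.2.1.2) ∂(Measure.pi fun _ : Edge d L => haarProbability G)) /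
          ∏ ℓ ∈ T, (∫ v, ∏ p ∈ C ℓ, w (plaquetteHolonomy (update U ℓ v) p.1 p.2.1.1 p.2.1.2) ∂(haarProbability G))))⁻¹)).comap
          (fun h : (i : ↥(Finset.Iic n)) → GaugeConfig d L G => h ⟨n, Finset.mem_Iic.2 le_rfl⟩)
          (measurable_pi_apply _))) (E ∩ {y : ℕ → GaugeConfig d L G | y 0 ≠ (fun _ : Edge d L => (1 : G))}) := by
  obtain ⟨hA, hρq, hmax, hρm, hρpos⟩ := allClosing_cold_acceptMass_eq hL hw hm0 hm hM hwinv T C hCne hCe hdisj hcover π q hπ hq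
  set cold : GaugeConfig d L G := fun _ => (1 : G) with hcold
  set ρ : GaugeConfig d L G → ℝ := fun U =>
    ((∫ V, ∏ p : Plaquette d L, w (plaquetteHolonomy V p.1 p.2.1.1 p.2.1.2) ∂(Measure.pi fun _ : Edge d L => haarProbability G)) /
      ∏ ℓ ∈ T, (∫ v, ∏ p ∈ C ℓ, w (plaquetteHolonomy (update U ℓ v) p.1 p.2.1.1 p.2.1.2) ∂(haarProbability G))) with hρ
  have hw0' : ∀ U, 0 < (ρ U)⁻¹ := fun U => inv_pos.2 (hρpos U)
  have hπ' : (q.withDensity fun U => ENNReal.ofReal (ρ U)⁻¹) = π := withDensity_inv_density hρm hρpos hρq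
  haveI : IsProbabilityMeasure (q.withDensity fun U => ENNReal.ofReal (ρ U)⁻¹) := by rw [hπ']; infer_instance
  have hone : ∫⁻ y, ENNReal.ofReal (ρ y)⁻¹ ∂q = ENNReal.ofReal 1 := by
    have h : π Set.univ = 1 := measure_univ
    rw [← hπ', withDensity_apply _ MeasurableSet.univ, Measure.restrict_univ] at h
    rw [h, ENNReal.ofReal_one]
  have hA' := imhAcceptMass_toReal_eq_of_forall_le (q := q) hw0' cold hmax zero_le_one hone
  have hrate : ((ρ cold)⁻¹)⁻¹ = ((∫ V, ∏ p : Plaquette d L, w (plaquetteHolonomy V p.1 p.2.1.1 p.2.1.2) ∂(Measure.pi fun _ : Edge d L => haarProbability G)) /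
        ∏ ℓ ∈ T, ∫ h, w h ^ (C ℓ).card ∂(haarProbability G)) := by
    rw [← hA, hA', one_div]
  have h := imh_chain_exitAt_inter_shift (q := q) hw0' hmax s hE (x₀ := cold)
  rw [hπ', hrate] at h
  exact h

/-- **THE EXIT TIME IS GEOMETRIC WITH SUCCESS PROBABILITY `A(1 − π₀)`**: `P_cold(U_0 = … = U_t = cold, U_{t+1} ≠ cold) = A·ρ^t·(1 − π₀)` — for `U(1)`, `SU(N)` (`π₀ = 0`) this is GEN-33's thaw time; for a finite group `π₀ > 0` and the chain also stays by ACCEPTING a cold proposal (exact all-closing conditioner). [ours] -/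
theorem allClosing_coldStart_exitAt [MeasurableSingletonClass G] (hL : 2 ≤ L) {w : G → ℝ} (hw : Continuous w) {m M : ℝ} (hm0 : 0 < m)
    (hm : ∀ g, m ≤ w g) (hM : ∀ g, w g ≤ M) (hwinv : ∀ g, w g⁻¹ = w g)
    (T : Finset (Edge d L)) (C : Edge d L → Finset (Plaquette d L))
    (hCne : ∀ ℓ ∈ T, (C ℓ).Nonempty)
    (hCe : ∀ ℓ ∈ T, ∀ p ∈ C ℓ, ℓ ∈ ({(p.1, p.2.1.1), (p.1.shift p.2.1.1, p.2.1.2),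
        (p.1.shift p.2.1.2, p.2.1.1), (p.1, p.2.1.2)} : Finset (Edge d L)))
    (hdisj : ∀ ℓ ∈ T, ∀ ℓ' ∈ T, ℓ ≠ ℓ' → Disjoint (C ℓ) (C ℓ'))
    (hcover : ∀ p : Plaquette d L, ∃ ℓ ∈ T, p ∈ C ℓ)
    (π q : Measure (GaugeConfig d L G)) [IsProbabilityMeasure π] [IsProbabilityMeasure q]
    (hπ : π = (Measure.pi fun _ : Edge d L => haarProbability G).withDensity fun U =>
      ENNReal.ofReal ((∏ p : Plaquette d L, w (plaquetteHolonomy U p.1 p.2.1.1 p.2.1.2)) /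
        ∫ V, ∏ p : Plaquette d L, w (plaquetteHolonomy V p.1 p.2.1.1 p.2.1.2) ∂(Measure.pi fun _ : Edge d L => haarProbability G)))
    (hq : q = (Measure.pi fun _ : Edge d L => haarProbability G).withDensity fun U =>
      ENNReal.ofReal (∏ ℓ ∈ T, (∏ p ∈ C ℓ, w (plaquetteHolonomy U p.1 p.2.1.1 p.2.1.2)) /
          (∫ v, ∏ p ∈ C ℓ, w (plaquetteHolonomy (update U ℓ v) p.1 p.2.1.1 p.2.1.2) ∂(haarProbability G))))
    [Fact (Measurable (fun U =>
        (((∫ V, ∏ p : Plaquette d L, w (plaquetteHolonomy V p.1 p.2.1.1 p.2.1.2) ∂(Measure.pi fun _ : Edge d L => haarProbability G)) /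
          ∏ ℓ ∈ T, (∫ v, ∏ p ∈ C ℓ, w (plaquetteHolonomy (update U ℓ v) p.1 p.2.1.1 p.2.1.2) ∂(haarProbability G))))⁻¹))] (s : ℕ) :
    (Kernel.trajMeasure (X := fun _ : ℕ => GaugeConfig d L G) (Measure.dirac (fun _ : Edge d L => (1 : G)))
        (fun n : ℕ => (indepMH q (fun U =>
        (((∫ V, ∏ p : Plaquette d L, w (plaquetteHolonomy V p.1 p.2.1.1 p.2.1.2) ∂(Measure.pi fun _ : Edge d L => haarProbability G)) /
          ∏ ℓ ∈ T, (∫ v, ∏ p ∈ C ℓ, w (plaquetteHolonomy (update U ℓ v) p.1 p.2.1.1 p.2.1.2) ∂(haarProbability G))))⁻¹)).comap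
          (fun h : (i : ↥(Finset.Iic n)) → GaugeConfig d L G => h ⟨n, Finset.mem_Iic.2 le_rfl⟩)
          (measurable_pi_apply _))).real
        {x : ℕ → GaugeConfig d L G | (∀ i, i ≤ s → x i = (fun _ : Edge d L => (1 : G))) ∧ x (s + 1) ≠ (fun _ : Edge d L => (1 : G))} =
      ((∫ V, ∏ p : Plaquette d L, w (plaquetteHolonomy V p.1 p.2.1.1 p.2.1.2) ∂(Measure.pi fun _ : Edge d L => haarProbability G)) /
        ∏ ℓ ∈ T, ∫ h, w h ^ (C ℓ).card ∂(haarProbability G)) * (1 - ((∫ V, ∏ p : Plaquette d L, w (plaquetteHolonomy V p.1 p.2.1.1 p.2.1.2) ∂(Measure.pi fun _ : Edge d L => haarProbability G)) /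
        ∏ ℓ ∈ T, ∫ h, w h ^ (C ℓ).card ∂(haarProbability G)) * (1 - π.real ({(fun _ : Edge d L => (1 : G))} : Set (GaugeConfig d L G)))) ^ s * (1 - π.real ({(fun _ : Edge d L => (1 : G))} : Set (GaugeConfig d L G))) := by
  obtain ⟨hA, hρq, hmax, hρm, hρpos⟩ := allClosing_cold_acceptMass_eq hL hw hm0 hm hM hwinv T C hCne hCe hdisj hcover π q hπ hq
  set cold : GaugeConfig d L G := fun _ => (1 : G) with hcold
  set ρ : GaugeConfig d L G → ℝ := fun U =>
    ((∫ V, ∏ p : Plaquette d L, w (plaquetteHolonomy V p.1 p.2.1.1 p.2.1.2) ∂(Measure.pi fun _ : Edge d L => haarProbability G)) /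
      ∏ ℓ ∈ T, (∫ v, ∏ p ∈ C ℓ, w (plaquetteHolonomy (update U ℓ v) p.1 p.2.1.1 p.2.1.2) ∂(haarProbability G))) with hρ
  have hw0' : ∀ U, 0 < (ρ U)⁻¹ := fun U => inv_pos.2 (hρpos U)
  have hπ' : (q.withDensity fun U => ENNReal.ofReal (ρ U)⁻¹) = π := withDensity_inv_density hρm hρpos hρq
  haveI : IsProbabilityMeasure (q.withDensity fun U => ENNReal.ofReal (ρ U)⁻¹) := by rw [hπ']; infer_instance
  have hone : ∫⁻ y, ENNReal.ofReal (ρ y)⁻¹ ∂q = ENNReal.ofReal 1 := by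
    have h : π Set.univ = 1 := measure_univ
    rw [← hπ', withDensity_apply _ MeasurableSet.univ, Measure.restrict_univ] at h
    rw [h, ENNReal.ofReal_one]
  have hA' := imhAcceptMass_toReal_eq_of_forall_le (q := q) hw0' cold hmax zero_le_one hone
  have hrate : ((ρ cold)⁻¹)⁻¹ = ((∫ V, ∏ p : Plaquette d L, w (plaquetteHolonomy V p.1 p.2.1.1 p.2.1.2) ∂(Measure.pi fun _ : Edge d L => haarProbability G)) /
        ∏ ℓ ∈ T, ∫ h, w h ^ (C ℓ).card ∂(haarProbability G)) := by
    rw [← hA, hA', one_div]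
  have h := imh_chain_exitAt (q := q) hw0' hmax s (x₀ := cold)
  rw [hπ', hrate] at h
  exact h

/-- **THE FIRST CONFIGURATION OFF THE COLD ONE**: `P_cold(U_0 = … = U_t = cold, U_{t+1} ≠ cold, U_{t+1} ∈ B) = A·ρ^t·π(B ∖ {cold})` — up to the geometric factor an exact draw from the target off the cold configuration (exact all-closing conditioner). [ours] -/
theorem allClosing_coldStart_firstExit [MeasurableSingletonClass G] (hL : 2 ≤ L) {w : G → ℝ} (hw : Continuous w) {m M : ℝ} (hm0 : 0 < m)
    (hm : ∀ g, m ≤ w g) (hM : ∀ g, w g ≤ M) (hwinv : ∀ g, w g⁻¹ = w g)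
    (T : Finset (Edge d L)) (C : Edge d L → Finset (Plaquette d L))
    (hCne : ∀ ℓ ∈ T, (C ℓ).Nonempty)
    (hCe : ∀ ℓ ∈ T, ∀ p ∈ C ℓ, ℓ ∈ ({(p.1, p.2.1.1), (p.1.shift p.2.1.1, p.2.1.2),
        (p.1.shift p.2.1.2, p.2.1.1), (p.1, p.2.1.2)} : Finset (Edge d L)))
    (hdisj : ∀ ℓ ∈ T, ∀ ℓ' ∈ T, ℓ ≠ ℓ' → Disjoint (C ℓ) (C ℓ'))
    (hcover : ∀ p : Plaquette d L, ∃ ℓ ∈ T, p ∈ C ℓ)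
    (π q : Measure (GaugeConfig d L G)) [IsProbabilityMeasure π] [IsProbabilityMeasure q]
    (hπ : π = (Measure.pi fun _ : Edge d L => haarProbability G).withDensity fun U =>
      ENNReal.ofReal ((∏ p : Plaquette d L, w (plaquetteHolonomy U p.1 p.2.1.1 p.2.1.2)) /
        ∫ V, ∏ p : Plaquette d L, w (plaquetteHolonomy V p.1 p.2.1.1 p.2.1.2) ∂(Measure.pi fun _ : Edge d L => haarProbability G)))
    (hq : q = (Measure.pi fun _ : Edge d L => haarProbability G).withDensity fun U =>
      ENNReal.ofReal (∏ ℓ ∈ T, (∏ p ∈ C ℓ, w (plaquetteHolonomy U p.1 p.2.1.1 p.2.1.2)) /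
          (∫ v, ∏ p ∈ C ℓ, w (plaquetteHolonomy (update U ℓ v) p.1 p.2.1.1 p.2.1.2) ∂(haarProbability G))))
    [Fact (Measurable (fun U =>
        (((∫ V, ∏ p : Plaquette d L, w (plaquetteHolonomy V p.1 p.2.1.1 p.2.1.2) ∂(Measure.pi fun _ : Edge d L => haarProbability G)) /
          ∏ ℓ ∈ T, (∫ v, ∏ p ∈ C ℓ, w (plaquetteHolonomy (update U ℓ v) p.1 p.2.1.1 p.2.1.2) ∂(haarProbability G))))⁻¹))] (s : ℕ)
    {B' : Set (GaugeConfig d L G)} (hB' : MeasurableSet B') :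
    (Kernel.trajMeasure (X := fun _ : ℕ => GaugeConfig d L G) (Measure.dirac (fun _ : Edge d L => (1 : G)))
        (fun n : ℕ => (indepMH q (fun U =>
        (((∫ V, ∏ p : Plaquette d L, w (plaquetteHolonomy V p.1 p.2.1.1 p.2.1.2) ∂(Measure.pi fun _ : Edge d L => haarProbability G)) /
          ∏ ℓ ∈ T, (∫ v, ∏ p ∈ C ℓ, w (plaquetteHolonomy (update U ℓ v) p.1 p.2.1.1 p.2.1.2) ∂(haarProbability G))))⁻¹)).comap
          (fun h : (i : ↥(Finset.Iic n)) → GaugeConfig d L G => h ⟨n, Finset.mem_Iic.2 le_rfl⟩)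
          (measurable_pi_apply _)))
        {x : ℕ → GaugeConfig d L G | (∀ i, i ≤ s → x i = (fun _ : Edge d L => (1 : G))) ∧ x (s + 1) ≠ (fun _ : Edge d L => (1 : G)) ∧ x (s + 1) ∈ B'} =
      ENNReal.ofReal (((∫ V, ∏ p : Plaquette d L, w (plaquetteHolonomy V p.1 p.2.1.1 p.2.1.2) ∂(Measure.pi fun _ : Edge d L => haarProbability G)) /
        ∏ ℓ ∈ T, ∫ h, w h ^ (C ℓ).card ∂(haarProbability G)) * (1 - ((∫ V, ∏ p : Plaquette d L, w (plaquetteHolonomy V p.1 p.2.1.1 p.2.1.2) ∂(Measure.pi fun _ : Edge d L => haarProbability G)) /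
        ∏ ℓ ∈ T, ∫ h, w h ^ (C ℓ).card ∂(haarProbability G)) * (1 - π.real ({(fun _ : Edge d L => (1 : G))} : Set (GaugeConfig d L G)))) ^ s) * π (B' \ ({(fun _ : Edge d L => (1 : G))} : Set (GaugeConfig d L G))) := by
  obtain ⟨hA, hρq, hmax, hρm, hρpos⟩ := allClosing_cold_acceptMass_eq hL hw hm0 hm hM hwinv T C hCne hCe hdisj hcover π q hπ hq
  set cold : GaugeConfig d L G := fun _ => (1 : G) with hcold
  set ρ : GaugeConfig d L G → ℝ := fun U =>
    ((∫ V, ∏ p : Plaquette d L, w (plaquetteHolonomy V p.1 p.2.1.1 p.2.1.2) ∂(Measure.pi fun _ : Edge d L => haarProbability G)) /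
      ∏ ℓ ∈ T, (∫ v, ∏ p ∈ C ℓ, w (plaquetteHolonomy (update U ℓ v) p.1 p.2.1.1 p.2.1.2) ∂(haarProbability G))) with hρ
  have hw0' : ∀ U, 0 < (ρ U)⁻¹ := fun U => inv_pos.2 (hρpos U)
  have hπ' : (q.withDensity fun U => ENNReal.ofReal (ρ U)⁻¹) = π := withDensity_inv_density hρm hρpos hρq
  haveI : IsProbabilityMeasure (q.withDensity fun U => ENNReal.ofReal (ρ U)⁻¹) := by rw [hπ']; infer_instance
  have hone : ∫⁻ y, ENNReal.ofReal (ρ y)⁻¹ ∂q = ENNReal.ofReal 1 := by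
    have h : π Set.univ = 1 := measure_univ
    rw [← hπ', withDensity_apply _ MeasurableSet.univ, Measure.restrict_univ] at h
    rw [h, ENNReal.ofReal_one]
  have hA' := imhAcceptMass_toReal_eq_of_forall_le (q := q) hw0' cold hmax zero_le_one hone
  have hrate : ((ρ cold)⁻¹)⁻¹ = ((∫ V, ∏ p : Plaquette d L, w (plaquetteHolonomy V p.1 p.2.1.1 p.2.1.2) ∂(Measure.pi fun _ : Edge d L => haarProbability G)) /
        ∏ ℓ ∈ T, ∫ h, w h ^ (C ℓ).card ∂(haarProbability G)) := by
    rw [← hA, hA', one_div]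
  have h := imh_chain_firstExit (q := q) hw0' hmax s hB' (x₀ := cold)
  rw [hπ', hrate] at h
  exact h

/-- **THE RUN AFTER THE FIRST EXIT IS THE EQUILIBRIUM RUN CONDITIONED TO START OFF THE COLD CONFIGURATION** (`π₀ < 1`): `P_cold(⋃_t {U_0 = … = U_t = cold, U_{t+1} ≠ cold, U_{t+1+·} ∈ E})·(1 − π₀) = P_π(E ∩ {U_0 ≠ cold})` — «discard until the chain first leaves the cold configuration» removes the cold start up to this explicit conditioning (exact all-closing conditioner). [ours] -/
theorem allClosing_coldStart_exitedRun [MeasurableSingletonClass G] (hL : 2 ≤ L) {w : G → ℝ} (hw : Continuous w) {m M : ℝ} (hm0 : 0 < m)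
    (hm : ∀ g, m ≤ w g) (hM : ∀ g, w g ≤ M) (hwinv : ∀ g, w g⁻¹ = w g)
    (T : Finset (Edge d L)) (C : Edge d L → Finset (Plaquette d L))
    (hCne : ∀ ℓ ∈ T, (C ℓ).Nonempty)
    (hCe : ∀ ℓ ∈ T, ∀ p ∈ C ℓ, ℓ ∈ ({(p.1, p.2.1.1), (p.1.shift p.2.1.1, p.2.1.2),
        (p.1.shift p.2.1.2, p.2.1.1), (p.1, p.2.1.2)} : Finset (Edge d L)))
    (hdisj : ∀ ℓ ∈ T, ∀ ℓ' ∈ T, ℓ ≠ ℓ' → Disjoint (C ℓ) (C ℓ'))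
    (hcover : ∀ p : Plaquette d L, ∃ ℓ ∈ T, p ∈ C ℓ)
    (π q : Measure (GaugeConfig d L G)) [IsProbabilityMeasure π] [IsProbabilityMeasure q]
    (hπ : π = (Measure.pi fun _ : Edge d L => haarProbability G).withDensity fun U =>
      ENNReal.ofReal ((∏ p : Plaquette d L, w (plaquetteHolonomy U p.1 p.2.1.1 p.2.1.2)) /
        ∫ V, ∏ p : Plaquette d L, w (plaquetteHolonomy V p.1 p.2.1.1 p.2.1.2) ∂(Measure.pi fun _ : Edge d L => haarProbability G)))
    (hq : q = (Measure.pi fun _ : Edge d L => haarProbability G).withDensity fun U =>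
      ENNReal.ofReal (∏ ℓ ∈ T, (∏ p ∈ C ℓ, w (plaquetteHolonomy U p.1 p.2.1.1 p.2.1.2)) /
          (∫ v, ∏ p ∈ C ℓ, w (plaquetteHolonomy (update U ℓ v) p.1 p.2.1.1 p.2.1.2) ∂(haarProbability G))))
    [Fact (Measurable (fun U =>
        (((∫ V, ∏ p : Plaquette d L, w (plaquetteHolonomy V p.1 p.2.1.1 p.2.1.2) ∂(Measure.pi fun _ : Edge d L => haarProbability G)) /
          ∏ ℓ ∈ T, (∫ v, ∏ p ∈ C ℓ, w (plaquetteHolonomy (update U ℓ v) p.1 p.2.1.1 p.2.1.2) ∂(haarProbability G))))⁻¹))]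
    (hπ0 : π.real ({(fun _ : Edge d L => (1 : G))} : Set (GaugeConfig d L G)) < 1) {E : Set (ℕ → GaugeConfig d L G)} (hE : MeasurableSet E) :
    (Kernel.trajMeasure (X := fun _ : ℕ => GaugeConfig d L G) (Measure.dirac (fun _ : Edge d L => (1 : G)))
        (fun n : ℕ => (indepMH q (fun U =>
        (((∫ V, ∏ p : Plaquette d L, w (plaquetteHolonomy V p.1 p.2.1.1 p.2.1.2) ∂(Measure.pi fun _ : Edge d L => haarProbability G)) /
          ∏ ℓ ∈ T, (∫ v, ∏ p ∈ C ℓ, w (plaquetteHolonomy (update U ℓ v) p.1 p.2.1.1 p.2.1.2) ∂(haarProbability G))))⁻¹)).comap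
          (fun h : (i : ↥(Finset.Iic n)) → GaugeConfig d L G => h ⟨n, Finset.mem_Iic.2 le_rfl⟩)
          (measurable_pi_apply _))).real (⋃ s : ℕ, {x : ℕ → GaugeConfig d L G | (∀ i, i ≤ s → x i = (fun _ : Edge d L => (1 : G))) ∧ x (s + 1) ≠ (fun _ : Edge d L => (1 : G)) ∧ (fun n => x (s + 1 + n)) ∈ E}) * (1 - π.real ({(fun _ : Edge d L => (1 : G))} : Set (GaugeConfig d L G))) =
      (Kernel.trajMeasure (X := fun _ : ℕ => GaugeConfig d L G) π
        (fun n : ℕ => (indepMH q (fun U =>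
        (((∫ V, ∏ p : Plaquette d L, w (plaquetteHolonomy V p.1 p.2.1.1 p.2.1.2) ∂(Measure.pi fun _ : Edge d L => haarProbability G)) /
          ∏ ℓ ∈ T, (∫ v, ∏ p ∈ C ℓ, w (plaquetteHolonomy (update U ℓ v) p.1 p.2.1.1 p.2.1.2) ∂(haarProbability G))))⁻¹)).comap
          (fun h : (i : ↥(Finset.Iic n)) → GaugeConfig d L G => h ⟨n, Finset.mem_Iic.2 le_rfl⟩)
          (measurable_pi_apply _))).real (E ∩ {y : ℕ → GaugeConfig d L G | y 0 ≠ (fun _ : Edge d L => (1 : G))}) := by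
  obtain ⟨hA, hρq, hmax, hρm, hρpos⟩ := allClosing_cold_acceptMass_eq hL hw hm0 hm hM hwinv T C hCne hCe hdisj hcover π q hπ hq
  set cold : GaugeConfig d L G := fun _ => (1 : G) with hcold
  set ρ : GaugeConfig d L G → ℝ := fun U =>
    ((∫ V, ∏ p : Plaquette d L, w (plaquetteHolonomy V p.1 p.2.1.1 p.2.1.2) ∂(Measure.pi fun _ : Edge d L => haarProbability G)) /
      ∏ ℓ ∈ T, (∫ v, ∏ p ∈ C ℓ, w (plaquetteHolonomy (update U ℓ v) p.1 p.2.1.1 p.2.1.2) ∂(haarProbability G))) with hρ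
  have hw0' : ∀ U, 0 < (ρ U)⁻¹ := fun U => inv_pos.2 (hρpos U)
  have hπ' : (q.withDensity fun U => ENNReal.ofReal (ρ U)⁻¹) = π := withDensity_inv_density hρm hρpos hρq
  haveI : IsProbabilityMeasure (q.withDensity fun U => ENNReal.ofReal (ρ U)⁻¹) := by rw [hπ']; infer_instance
  have hone : ∫⁻ y, ENNReal.ofReal (ρ y)⁻¹ ∂q = ENNReal.ofReal 1 := by
    have h : π Set.univ = 1 := measure_univ
    rw [← hπ', withDensity_apply _ MeasurableSet.univ, Measure.restrict_univ] at h
    rw [h, ENNReal.ofReal_one]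
  have hA' := imhAcceptMass_toReal_eq_of_forall_le (q := q) hw0' cold hmax zero_le_one hone
  have hrate : ((ρ cold)⁻¹)⁻¹ = ((∫ V, ∏ p : Plaquette d L, w (plaquetteHolonomy V p.1 p.2.1.1 p.2.1.2) ∂(Measure.pi fun _ : Edge d L => haarProbability G)) /
        ∏ ℓ ∈ T, ∫ h, w h ^ (C ℓ).card ∂(haarProbability G)) := by
    rw [← hA, hA', one_div]
  rw [← hπ'] at hπ0
  have h := imh_chain_exitedRun_real (q := q) hw0' hmax hπ0 hE (x₀ := cold)
  rw [hπ'] at h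
  exact h

/-- **THE CHAIN LEAVES THE COLD CONFIGURATION ALMOST SURELY** (`π₀ < 1`) (exact all-closing conditioner). [ours] -/
theorem allClosing_coldStart_exits [MeasurableSingletonClass G] (hL : 2 ≤ L) {w : G → ℝ} (hw : Continuous w) {m M : ℝ} (hm0 : 0 < m)
    (hm : ∀ g, m ≤ w g) (hM : ∀ g, w g ≤ M) (hwinv : ∀ g, w g⁻¹ = w g)
    (T : Finset (Edge d L)) (C : Edge d L → Finset (Plaquette d L))
    (hCne : ∀ ℓ ∈ T, (C ℓ).Nonempty)
    (hCe : ∀ ℓ ∈ T, ∀ p ∈ C ℓ, ℓ ∈ ({(p.1, p.2.1.1), (p.1.shift p.2.1.1, p.2.1.2),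
        (p.1.shift p.2.1.2, p.2.1.1), (p.1, p.2.1.2)} : Finset (Edge d L)))
    (hdisj : ∀ ℓ ∈ T, ∀ ℓ' ∈ T, ℓ ≠ ℓ' → Disjoint (C ℓ) (C ℓ'))
    (hcover : ∀ p : Plaquette d L, ∃ ℓ ∈ T, p ∈ C ℓ)
    (π q : Measure (GaugeConfig d L G)) [IsProbabilityMeasure π] [IsProbabilityMeasure q]
    (hπ : π = (Measure.pi fun _ : Edge d L => haarProbability G).withDensity fun U =>
      ENNReal.ofReal ((∏ p : Plaquette d L, w (plaquetteHolonomy U p.1 p.2.1.1 p.2.1.2)) /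
        ∫ V, ∏ p : Plaquette d L, w (plaquetteHolonomy V p.1 p.2.1.1 p.2.1.2) ∂(Measure.pi fun _ : Edge d L => haarProbability G)))
    (hq : q = (Measure.pi fun _ : Edge d L => haarProbability G).withDensity fun U =>
      ENNReal.ofReal (∏ ℓ ∈ T, (∏ p ∈ C ℓ, w (plaquetteHolonomy U p.1 p.2.1.1 p.2.1.2)) /
          (∫ v, ∏ p ∈ C ℓ, w (plaquetteHolonomy (update U ℓ v) p.1 p.2.1.1 p.2.1.2) ∂(haarProbability G))))
    [Fact (Measurable (fun U =>
        (((∫ V, ∏ p : Plaquette d L, w (plaquetteHolonomy V p.1 p.2.1.1 p.2.1.2) ∂(Measure.pi fun _ : Edge d L => haarProbability G)) /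
          ∏ ℓ ∈ T, (∫ v, ∏ p ∈ C ℓ, w (plaquetteHolonomy (update U ℓ v) p.1 p.2.1.1 p.2.1.2) ∂(haarProbability G))))⁻¹))]
    (hπ0 : π.real ({(fun _ : Edge d L => (1 : G))} : Set (GaugeConfig d L G)) < 1) :
    (Kernel.trajMeasure (X := fun _ : ℕ => GaugeConfig d L G) (Measure.dirac (fun _ : Edge d L => (1 : G)))
        (fun n : ℕ => (indepMH q (fun U =>
        (((∫ V, ∏ p : Plaquette d L, w (plaquetteHolonomy V p.1 p.2.1.1 p.2.1.2) ∂(Measure.pi fun _ : Edge d L => haarProbability G)) /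
          ∏ ℓ ∈ T, (∫ v, ∏ p ∈ C ℓ, w (plaquetteHolonomy (update U ℓ v) p.1 p.2.1.1 p.2.1.2) ∂(haarProbability G))))⁻¹)).comap
          (fun h : (i : ↥(Finset.Iic n)) → GaugeConfig d L G => h ⟨n, Finset.mem_Iic.2 le_rfl⟩)
          (measurable_pi_apply _)))
        (⋃ t : ℕ, {x : ℕ → GaugeConfig d L G | (∀ i, i ≤ t → x i = (fun _ : Edge d L => (1 : G))) ∧ x (t + 1) ≠ (fun _ : Edge d L => (1 : G))}) = 1 := by
  obtain ⟨hA, hρq, hmax, hρm, hρpos⟩ := allClosing_cold_acceptMass_eq hL hw hm0 hm hM hwinv T C hCne hCe hdisj hcover π q hπ hq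
  set cold : GaugeConfig d L G := fun _ => (1 : G) with hcold
  set ρ : GaugeConfig d L G → ℝ := fun U =>
    ((∫ V, ∏ p : Plaquette d L, w (plaquetteHolonomy V p.1 p.2.1.1 p.2.1.2) ∂(Measure.pi fun _ : Edge d L => haarProbability G)) /
      ∏ ℓ ∈ T, (∫ v, ∏ p ∈ C ℓ, w (plaquetteHolonomy (update U ℓ v) p.1 p.2.1.1 p.2.1.2) ∂(haarProbability G))) with hρ
  have hw0' : ∀ U, 0 < (ρ U)⁻¹ := fun U => inv_pos.2 (hρpos U)
  have hπ' : (q.withDensity fun U => ENNReal.ofReal (ρ U)⁻¹) = π := withDensity_inv_density hρm hρpos hρq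
  haveI : IsProbabilityMeasure (q.withDensity fun U => ENNReal.ofReal (ρ U)⁻¹) := by rw [hπ']; infer_instance
  have hone : ∫⁻ y, ENNReal.ofReal (ρ y)⁻¹ ∂q = ENNReal.ofReal 1 := by
    have h : π Set.univ = 1 := measure_univ
    rw [← hπ', withDensity_apply _ MeasurableSet.univ, Measure.restrict_univ] at h
    rw [h, ENNReal.ofReal_one]
  have hA' := imhAcceptMass_toReal_eq_of_forall_le (q := q) hw0' cold hmax zero_le_one hone
  have hrate : ((ρ cold)⁻¹)⁻¹ = ((∫ V, ∏ p : Plaquette d L, w (plaquetteHolonomy V p.1 p.2.1.1 p.2.1.2) ∂(Measure.pi fun _ : Edge d L => haarProbability G)) /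
        ∏ ℓ ∈ T, ∫ h, w h ^ (C ℓ).card ∂(haarProbability G)) := by
    rw [← hA, hA', one_div]
  rw [← hπ'] at hπ0
  exact imh_chain_exits (q := q) hw0' hmax hπ0 (x₀ := cold)

end Summit.Ventures.LatticeQCDFlow.Theory2.Autoregressive

end
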